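import Literature.Probability.RandomMatrix.HaarCornerConditional
import Literature.Probability.RandomMatrix.HaarUnitaryColumns
import Literature.LinearAlgebra.Matrix.RankOneDowndate
import HarnessLib

/-!
# The law of a corner of a Haar unitary (Collins 2005, Thm. 5.1)

`Literature/Probability/RandomMatrix/`. For `p + q ≤ m`, the upper-left `p × q` corner `A` of a
Haar-random `U ∈ U(m)` has a density with respect to Lebesgue measure on `ℂ^{p × q}`,
proportional to

`det (1 - A A*)^{m - p - q} 𝟙_{A A* < 1}`

(`map_haarCorner_eq_withDensity`; B. Collins, *Product of random projections, Jacobi ensembles and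
universality problems arising from free probability*, PTRF 133 (2005) 315–344, Thm. 5.1, quoting
Collins' thesis (Paris 6, 2003) — stated there for `m ≥ 2p ≥ 2q` with the indicator `‖A‖ ≤ 1`,
which differs from `A A* < 1 ⟺ ‖A‖ < 1` on a null set; also Petz–Réffy, PTRF 133 (2005), Appendix,
for `p = q`). The corner is handled as the `q`-tuple of its columns `aⱼ ∈ ℂ^p`, so that
`1 - A A* = 1 - ∑ⱼ aⱼ aⱼ*` (`oneSubGram`) and the density is `cornerDensity`.

## Proof (column induction)

By `map_firstCols_haar_eq_map_gramSchmidtNormed` the corner has the law of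
`A = top_p (GSN(g₁, …, g_q))` for independent standard Gaussian vectors `gⱼ` of `ℂ^m`
(`cornerCols`). Induct on `q` (`map_cornerCols_eq_withDensity`). Appending a column
`g = g_{q+1}`: the new Gram–Schmidt vector is the normalised residual `r/‖r‖`,
`r = g - P_K g`, `K = span(g₁,…,g_q)` (`gramSchmidt_last_eq_sub_starProjection`); in an orthonormal
basis of `ℂ^m` adapted to `K ⊕ Kᗮ` whose `K`-part is `GSN(g₁,…,g_q)` the coordinates of `g` are
independent standard Gaussians (`map_euclSplit_repr_stdGaussian`), `r = ∑ₖ cₖ bₖ` with `c` the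
`Kᗮ`-coordinates, and the new corner column is `‖c‖⁻¹ N c` with `N` the top `p` rows of the `bₖ`;
completeness of the adapted basis gives `A' A'* + N N* = 1`, i.e. `N N* = 1 - ∑ⱼ a'ⱼ a'ⱼ*`
(`oneSubGram`). The conditional law of the new column given the previous ones is therefore
`K (det C)⁻¹ (1 - a* C⁻¹ a)^{m-p-q-1} 𝟙` with `C = 1 - ∑ a'ⱼ a'ⱼ*`
(`map_normalizeMulVec_stdGaussian`), and the rank-one downdate identities
`det (C - a a*) = det C (1 - a* C⁻¹ a)`, `C - a a* > 0 ⟺ C > 0 ∧ a* C⁻¹ a < 1`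
(`RankOneDowndate.lean`) turn `density(A') × conditional density` into
`det (1 - ∑_{j ≤ q} aⱼ aⱼ*)^{m-p-q-1} 𝟙`.
-/

noncomputable section

open MeasureTheory ProbabilityTheory Set Module Matrix Complex InnerProductSpace
open Literature.Probability.Distributions Literature.Analysis.InnerProduct
open Literature.LinearAlgebra.Matrix (oneSubGram oneSubGram_snoc oneSubGram_zero isHermitian_oneSubGram
  det_re_sub_vecMulVec posDef_sub_vecMulVec_iff posDef_of_posDef_sub_vecMulVec det_re_pos_of_posDef)
open Literature.MathematicalPhysics.QuantumFieldTheory (haarProbability)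
open scoped ENNReal ComplexOrder InnerProductSpace

namespace Literature.Probability.RandomMatrix

variable {m p : ℕ}

/-! ### The top rows and the corner columns -/

/-- The top `p` coordinates of a vector of `ℂ^m` (`p ≤ m`), a linear map `ℂ^m → ℂ^p`. [folklore] -/
def topLin (hp : p ≤ m) : EuclideanSpace ℂ (Fin m) →ₗ[ℂ] EuclideanSpace ℂ (Fin p) where
  toFun v := WithLp.toLp 2 fun i => v (Fin.castLE hp i)
  map_add' v w := by ext i; simp
  map_smul' c v := by ext i; simp

/-- Coordinates of `topLin`. [folklore] -/
@[simp] theorem topLin_apply (hp : p ≤ m) (v : EuclideanSpace ℂ (Fin m)) (i : Fin p) :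
    topLin hp v i = v (Fin.castLE hp i) := rfl

/-- `topLin` is continuous. [folklore] -/
theorem continuous_topLin (hp : p ≤ m) : Continuous (topLin hp) :=
  (topLin hp).continuous_of_finiteDimensional

/-- Real scalars pass through `topLin`. [folklore] -/
theorem topLin_real_smul (hp : p ≤ m) (r : ℝ) (v : EuclideanSpace ℂ (Fin m)) :
    topLin hp (r • v) = r • topLin hp v := by
  ext i; simp

/-- The **corner columns**: the top `p` entries of the Gram–Schmidt orthonormalisation of a
`q`-tuple of vectors of `ℂ^m` — for Gaussian vectors, the columns of the `p × q` corner of a Haar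
unitary (`map_firstCols_haar_eq_map_gramSchmidtNormed`). [folklore] -/
def cornerCols (hp : p ≤ m) {q : ℕ} (f : Fin q → EuclideanSpace ℂ (Fin m)) :
    Fin q → EuclideanSpace ℂ (Fin p) :=
  fun j => topLin hp (gramSchmidtNormed ℂ f j)

/-- `cornerCols` is measurable. [folklore] -/
theorem measurable_cornerCols (hp : p ≤ m) (q : ℕ) :
    Measurable (cornerCols hp (q := q)) :=
  measurable_pi_lambda _ fun j =>
    (continuous_topLin hp).measurable.comp (measurable_gramSchmidtNormed_apply ℂ j)

/-- The **Gram complement** `1 - ∑ⱼ aⱼ aⱼ* = 1 - A A*` of a tuple of columns `aⱼ ∈ ℂ^p`.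
[folklore] -/
def gramCompl {q : ℕ} (A : Fin q → EuclideanSpace ℂ (Fin p)) : Matrix (Fin p) (Fin p) ℂ :=
  oneSubGram fun j => (A j).ofLp

/-- Appending a column downdates the Gram complement. [folklore] -/
theorem gramCompl_snoc {q : ℕ} (A : Fin q → EuclideanSpace ℂ (Fin p)) (a : EuclideanSpace ℂ (Fin p)) :
    gramCompl (Fin.snoc A a : Fin (q + 1) → EuclideanSpace ℂ (Fin p)) =
      gramCompl A - vecMulVec a.ofLp (star a.ofLp) := by
  unfold gramCompl
  rw [← oneSubGram_snoc]
  congr 1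
  funext j
  refine Fin.lastCases ?_ (fun i => ?_) j
  · simp
  · simp

open Classical in
/-- The **corner density** `det (1 - ∑ⱼ aⱼ aⱼ*)^e 𝟙_{1 - ∑ⱼ aⱼ aⱼ* > 0}` (exponent
`e = m - p - q`). [cite: Collins2005, Thm. 5.1] -/
def cornerDensity (e : ℕ) {q : ℕ} (A : Fin q → EuclideanSpace ℂ (Fin p)) : ℝ :=
  if (gramCompl A).PosDef then ((gramCompl A).det.re) ^ e else 0

/-- The corner density is nonnegative. [folklore] -/
theorem cornerDensity_nonneg (e : ℕ) {q : ℕ} (A : Fin q → EuclideanSpace ℂ (Fin p)) :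
    0 ≤ cornerDensity e A := by
  unfold cornerDensity
  split_ifs with h
  · exact pow_nonneg (det_re_pos_of_posDef h).1.le _
  · exact le_rfl

/-! ### Measurability of the corner density -/

/-- The Gram complement depends continuously on the columns. [folklore] -/
theorem continuous_gramCompl (q : ℕ) :
    Continuous (gramCompl (p := p) (q := q)) := by
  have hA : ∀ (j : Fin q) (i : Fin p),
      Continuous fun A : Fin q → EuclideanSpace ℂ (Fin p) => (A j).ofLp i := fun j i =>
    (continuous_apply i).comp ((PiLp.continuous_ofLp 2 _).comp (continuous_apply j))
  refine continuous_matrix fun i k => ?_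
  simp only [gramCompl, oneSubGram, Matrix.sub_apply, Matrix.sum_apply, vecMulVec_apply, Pi.star_apply]
  exact continuous_const.sub (continuous_finsetSum _ fun j _ => (hA j i).mul (hA j k).star)

/-- The positive semidefinite locus `{C | ∀ x, 0 ≤ x* C x}` pulled back along a continuous
matrix-valued map is closed. [folklore] -/
theorem isClosed_setOf_dotProduct_mulVec_nonneg {X : Type*} [TopologicalSpace X]
    {C : X → Matrix (Fin p) (Fin p) ℂ} (hC : Continuous C) :
    IsClosed {x | ∀ v : Fin p → ℂ, 0 ≤ star v ⬝ᵥ C x *ᵥ v} := by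
  have h0 : IsClosed {z : ℂ | 0 ≤ z} := by
    have : {z : ℂ | 0 ≤ z} = Complex.re ⁻¹' Ici 0 ∩ Complex.im ⁻¹' {0} := by
      ext z; simp [Complex.nonneg_iff, eq_comm]
    rw [this]
    exact (isClosed_Ici.preimage Complex.continuous_re).inter
      ((isClosed_singleton).preimage Complex.continuous_im)
  simp only [setOf_forall]
  refine isClosed_iInter fun v => h0.preimage ?_
  simp only [dotProduct, mulVec]
  refine continuous_finsetSum _ fun i _ => continuous_const.mul
    (continuous_finsetSum _ fun k _ => Continuous.mul ?_ continuous_const)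
  exact (continuous_apply_apply i k).comp hC

/-- The locus where the Gram complement is positive definite is measurable (positive
semidefiniteness is a closed condition, invertibility an open one). [folklore] -/
theorem measurableSet_posDef_gramCompl (q : ℕ) :
    MeasurableSet {A : Fin q → EuclideanSpace ℂ (Fin p) | (gramCompl A).PosDef} := by
  have hcont := continuous_gramCompl (p := p) q
  have heq : {A : Fin q → EuclideanSpace ℂ (Fin p) | (gramCompl A).PosDef} =
      {A | ∀ v : Fin p → ℂ, 0 ≤ star v ⬝ᵥ gramCompl A *ᵥ v} ∩ {A | (gramCompl A).det ≠ 0} := by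
    ext A
    simp only [mem_setOf_eq, mem_inter_iff]
    constructor
    · intro h
      exact ⟨h.posSemidef.dotProduct_mulVec_nonneg, h.det_pos.ne'⟩
    · rintro ⟨h1, h2⟩
      have hpsd : (gramCompl A).PosSemidef :=
        PosSemidef.of_dotProduct_mulVec_nonneg (isHermitian_oneSubGram _) h1
      exact hpsd.posDef_iff_det_ne_zero.2 h2
  rw [heq]
  refine (isClosed_setOf_dotProduct_mulVec_nonneg hcont).measurableSet.inter ?_
  exact (isOpen_ne.preimage (hcont.matrix_det)).measurableSet

/-- The corner density is measurable. [folklore] -/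
@[fun_prop]
theorem measurable_cornerDensity (e q : ℕ) :
    Measurable (cornerDensity (p := p) e (q := q)) := by
  unfold cornerDensity
  refine Measurable.ite (measurableSet_posDef_gramCompl q) ?_ measurable_const
  exact (Complex.continuous_re.comp ((continuous_gramCompl q).matrix_det)).measurable.pow_const _

/-! ### The law of the corner columns -/

variable (m) in
/-- The law of the corner columns of a `q`-tuple of independent standard Gaussian vectors of
`ℂ^m`. [folklore] -/
def cornerLaw (hp : p ≤ m) (q : ℕ) : Measure (Fin q → EuclideanSpace ℂ (Fin p)) :=
  (gaussianCols m q).map (cornerCols hp)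

/-- The corner law is a probability measure. [folklore] -/
instance (hp : p ≤ m) (q : ℕ) : IsProbabilityMeasure (cornerLaw m hp q) :=
  Measure.isProbabilityMeasure_map (measurable_cornerCols hp q).aemeasurable

/-- **Base case**: with no column the law is the point mass and the density is `1`. [folklore] -/
theorem cornerLaw_zero (hp : p ≤ m) :
    cornerLaw m hp 0 = volume.withDensity fun A => ENNReal.ofReal (1 * cornerDensity (m - p) A) := by
  have hdens : ∀ A : Fin 0 → EuclideanSpace ℂ (Fin p), cornerDensity (m - p) A = 1 := by
    intro A
    have h1 : gramCompl A = 1 := oneSubGram_zero _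
    simp [cornerDensity, h1, PosDef.one]
  simp_rw [one_mul, hdens, ENNReal.ofReal_one]
  rw [show (fun _ : Fin 0 → EuclideanSpace ℂ (Fin p) => (1 : ℝ≥0∞)) = 1 from rfl, withDensity_one]
  -- two probability measures on a one-point space
  have hvol : (volume : Measure (Fin 0 → EuclideanSpace ℂ (Fin p))) = Measure.dirac default := by
    rw [volume_pi, Measure.pi_of_empty _ default]
  rw [hvol]
  ext s hs
  by_cases h : (default : Fin 0 → EuclideanSpace ℂ (Fin p)) ∈ s
  · have hs' : s = univ := by
      ext x; simp only [mem_univ, iff_true]; rwa [Subsingleton.elim x default]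
    rw [hs', measure_univ, measure_univ]
  · have hs' : s = ∅ := by
      ext x; simp only [mem_empty_iff_false, iff_false]; rwa [Subsingleton.elim x default]
    rw [hs', measure_empty, measure_empty]

/-! ### The inductive step: structure of the new column -/

section Step

variable {q : ℕ} (hp : p ≤ m)

/-- The first `q` corner columns of a `(q+1)`-tuple are those of its first `q` vectors
(Gram–Schmidt is sequential). [folklore] -/
theorem cornerCols_snoc_castSucc (f' : Fin q → EuclideanSpace ℂ (Fin m)) (g : EuclideanSpace ℂ (Fin m))
    (j : Fin q) :
    cornerCols hp (Fin.snoc f' g : Fin (q + 1) → EuclideanSpace ℂ (Fin m)) (Fin.castSucc j) =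
      cornerCols hp f' j := by
  have h : (Fin.snoc f' g : Fin (q + 1) → EuclideanSpace ℂ (Fin m)) ∘ Fin.castSucc = f' :=
    Fin.snoc_comp_castSucc
  show topLin hp (gramSchmidtNormed ℂ (Fin.snoc f' g : Fin (q + 1) → EuclideanSpace ℂ (Fin m))
    (Fin.castSucc j)) = topLin hp (gramSchmidtNormed ℂ f' j)
  rw [← gramSchmidtNormed_comp_castSucc ℂ (Fin.snoc f' g : Fin (q + 1) → EuclideanSpace ℂ (Fin m)) j, h]

/-- **Structure of the new column.** Fix linearly independent `f' = (g₁, …, g_q)`, let `e = GSN f'`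
(an orthonormal basis of `K = span f'`), `b₂` an orthonormal basis of `Kᗮ` indexed by `Fin (m - q)`,
`B` the adapted basis of `ℂ^m` and `N` the top `p` rows of `b₂`. Then for every `g`, the corner
columns of `(f', g)` are those of `f'` followed by `‖c‖⁻¹ N c`, `c` the `Kᗮ`-coordinates of `g`,
and `N N* = 1 - ∑ⱼ a'ⱼ a'ⱼ*`. [folklore] -/
theorem exists_cornerCols_snoc_eq (hqm : q ≤ m) {f' : Fin q → EuclideanSpace ℂ (Fin m)}
    (hli : LinearIndependent ℂ f') :
    ∃ (B : OrthonormalBasis (Fin q ⊕ Fin (m - q)) ℂ (EuclideanSpace ℂ (Fin m)))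
      (N : Matrix (Fin p) (Fin (m - q)) ℂ),
      N * Nᴴ = gramCompl (cornerCols hp f') ∧
      ∀ g : EuclideanSpace ℂ (Fin m),
        cornerCols hp (Fin.snoc f' g : Fin (q + 1) → EuclideanSpace ℂ (Fin m)) =
          (Fin.snoc (cornerCols hp f') (normalizeMulVec N (euclSplit (B.repr g)).2) :
            Fin (q + 1) → EuclideanSpace ℂ (Fin p)) := by
  -- the Gram–Schmidt basis of `K`
  set e : Fin q → EuclideanSpace ℂ (Fin m) := gramSchmidtNormed ℂ f' with he
  have hon : Orthonormal ℂ e := gramSchmidtNormed_orthonormal hli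
  set K : Submodule ℂ (EuclideanSpace ℂ (Fin m)) := Submodule.span ℂ (Set.range e) with hK
  have hKf : K = Submodule.span ℂ (Set.range f') := by
    rw [hK, he, span_gramSchmidtNormed_range, span_gramSchmidt]
  let fK : Fin q → K := fun j => ⟨e j, Submodule.subset_span (Set.mem_range_self j)⟩
  have hfK : Orthonormal ℂ fK := by
    have hon' := hon
    rw [orthonormal_iff_ite] at hon' ⊢
    intro i j
    rw [Submodule.coe_inner]
    exact hon' i j
  have hrange : Set.range fK = ((↑) : K → EuclideanSpace ℂ (Fin m)) ⁻¹' Set.range e := by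
    ext x
    constructor
    · rintro ⟨j, rfl⟩; exact ⟨j, rfl⟩
    · rintro ⟨j, hj⟩; exact ⟨j, Subtype.ext hj⟩
  let b₁ : OrthonormalBasis (Fin q) ℂ K := OrthonormalBasis.mk hfK (by
    rw [hrange, Submodule.span_span_coe_preimage])
  have hb₁ : ∀ j, (b₁ j : EuclideanSpace ℂ (Fin m)) = e j := fun j => by
    simp [b₁, fK]
  -- an orthonormal basis of `Kᗮ`
  have hKq : finrank ℂ K = q := (finrank_span_eq_card hon.linearIndependent).trans (Fintype.card_fin q)
  have hKo : finrank ℂ Kᗮ = m - q := by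
    have := Submodule.finrank_add_finrank_orthogonal K
    rw [hKq, finrank_euclideanSpace, Fintype.card_fin] at this
    omega
  let b₂ : OrthonormalBasis (Fin (m - q)) ℂ Kᗮ := (stdOrthonormalBasis ℂ Kᗮ).reindex (finCongr hKo)
  let B : OrthonormalBasis (Fin q ⊕ Fin (m - q)) ℂ (EuclideanSpace ℂ (Fin m)) :=
    K.sumOrthonormalBasis b₁ b₂
  -- the top rows of `b₂`
  let N : Matrix (Fin p) (Fin (m - q)) ℂ :=
    Matrix.of fun i k => (b₂ k : EuclideanSpace ℂ (Fin m)) (Fin.castLE hp i)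
  refine ⟨B, N, ?_, ?_⟩
  · -- `N N* = 1 - ∑ a'ⱼ a'ⱼ*` from completeness of `B`
    have hcomp := sum_vecMulVec_orthonormalBasis B
    rw [Fintype.sum_sum_type] at hcomp
    simp only [B, Submodule.sumOrthonormalBasis_apply_inl, Submodule.sumOrthonormalBasis_apply_inr,
      hb₁] at hcomp
    -- take the top-left `p × p` block
    have hblock : ∀ M₁ M₂ : Matrix (Fin m) (Fin m) ℂ, M₁ = M₂ →
        (Matrix.of fun i i' => M₁ (Fin.castLE hp i) (Fin.castLE hp i')) =
          Matrix.of fun i i' => M₂ (Fin.castLE hp i) (Fin.castLE hp i') := by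
      rintro M₁ M₂ rfl; rfl
    have h2 := hblock _ _ hcomp
    have hNN : N * Nᴴ = Matrix.of fun i i' =>
        (∑ k, vecMulVec (b₂ k : EuclideanSpace ℂ (Fin m)).ofLp
          (star (b₂ k : EuclideanSpace ℂ (Fin m)).ofLp)) (Fin.castLE hp i) (Fin.castLE hp i') := by
      ext i i'
      simp [N, Matrix.mul_apply, Matrix.sum_apply, vecMulVec_apply]
    have hAA : (∑ j, vecMulVec (cornerCols hp f' j).ofLp (star (cornerCols hp f' j).ofLp)) =
        Matrix.of fun i i' => (∑ j, vecMulVec (e j).ofLp (star (e j).ofLp))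
          (Fin.castLE hp i) (Fin.castLE hp i') := by
      ext i i'
      simp [cornerCols, Matrix.sum_apply, vecMulVec_apply, he]
    have hone : (Matrix.of fun i i' => (1 : Matrix (Fin m) (Fin m) ℂ) (Fin.castLE hp i) (Fin.castLE hp i')) =
        (1 : Matrix (Fin p) (Fin p) ℂ) := by
      ext i i'
      simp [Matrix.one_apply, (Fin.castLE_injective hp).eq_iff]
    rw [gramCompl, oneSubGram, hNN, hAA, eq_sub_iff_add_eq, add_comm]
    rw [← hone, ← h2]
    ext i i'
    simp [Matrix.add_apply]
  · -- the new column
    intro g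
    funext j
    refine Fin.lastCases ?_ (fun i => ?_) j
    · rw [Fin.snoc_last]
      unfold cornerCols
      -- the last Gram–Schmidt vector is the normalised residual `∑ₖ cₖ b₂ k`
      have hres : gramSchmidt ℂ (Fin.snoc f' g : Fin (q + 1) → EuclideanSpace ℂ (Fin m)) (Fin.last q) =
          ∑ k, (euclSplit (B.repr g)).2 k • (b₂ k : EuclideanSpace ℂ (Fin m)) := by
        rw [gramSchmidt_last_eq_sub_starProjection, Fin.snoc_comp_castSucc, Fin.snoc_last, ← hKf,
          ← K.sum_inner_smul_eq_sub_starProjection b₂ g]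
        refine Finset.sum_congr rfl fun k _ => ?_
        congr 1
        rw [euclSplit_snd_apply, OrthonormalBasis.repr_apply_apply]
        simp [B]
      -- its norm is `‖c‖`
      have hsynth : ∑ k, (euclSplit (B.repr g)).2 k • (b₂ k : EuclideanSpace ℂ (Fin m)) =
          ((b₂.repr.symm (euclSplit (B.repr g)).2 : Kᗮ) : EuclideanSpace ℂ (Fin m)) := by
        rw [← b₂.sum_repr_symm, Submodule.coe_sum]
        rfl
      have hnorm : ‖gramSchmidt ℂ (Fin.snoc f' g : Fin (q + 1) → EuclideanSpace ℂ (Fin m)) (Fin.last q)‖ =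
          ‖(euclSplit (B.repr g)).2‖ := by
        rw [hres, hsynth]
        exact (Kᗮ.subtypeₗᵢ.norm_map _).trans (b₂.repr.symm.norm_map _)
      -- the top rows
      have htop : topLin hp (∑ k, (euclSplit (B.repr g)).2 k • (b₂ k : EuclideanSpace ℂ (Fin m))) =
          WithLp.toLp 2 (N *ᵥ (euclSplit (B.repr g)).2.ofLp) := by
        ext i
        simp [map_sum, map_smul, N, mulVec, dotProduct, Finset.sum_apply, mul_comm]
      rw [gramSchmidtNormed, hnorm, hres]
      rw [← RCLike.ofReal_inv, ← RCLike.real_smul_eq_coe_smul (K := ℂ), topLin_real_smul, htop]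
      rfl
    · rw [Fin.snoc_castSucc, cornerCols_snoc_castSucc]

end Step

/-! ### The inductive step: the density identity -/

/-- **Density of `q + 1` columns from density of `q` columns and the conditional density**:
`ρ_q(A') · condDensity(C(A'), a) = ρ_{q+1}(A', a)` for all `A'`, `a`, where the exponents are
`e + 1`, `e`, `e`. The rank-one downdate identities of `RankOneDowndate.lean`. [folklore] -/
theorem cornerDensity_mul_condDensity (e : ℕ) {q : ℕ} (A' : Fin q → EuclideanSpace ℂ (Fin p))
    (a : EuclideanSpace ℂ (Fin p)) :
    cornerDensity (e + 1) A' * condDensity e (gramCompl A') a =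
      cornerDensity e (Fin.snoc A' a : Fin (q + 1) → EuclideanSpace ℂ (Fin p)) := by
  rw [cornerDensity, cornerDensity, gramCompl_snoc]
  by_cases hC : (gramCompl A').PosDef
  · rw [if_pos hC, condDensity]
    have hd : 0 < (gramCompl A').det.re := (det_re_pos_of_posDef hC).1
    by_cases hlt : quadInv (gramCompl A') a < 1
    · have hpd : (gramCompl A' - vecMulVec a.ofLp (star a.ofLp)).PosDef :=
        (posDef_sub_vecMulVec_iff hC a.ofLp).2 hlt
      rw [if_pos hlt, if_pos hpd, det_re_sub_vecMulVec hC, mul_pow, pow_succ]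
      unfold quadInv
      field_simp
    · have hnpd : ¬ (gramCompl A' - vecMulVec a.ofLp (star a.ofLp)).PosDef :=
        fun h => hlt ((posDef_sub_vecMulVec_iff hC a.ofLp).1 h)
      rw [if_neg hlt, if_neg hnpd, mul_zero]
  · have hnpd : ¬ (gramCompl A' - vecMulVec a.ofLp (star a.ofLp)).PosDef :=
      fun h => hC (posDef_of_posDef_sub_vecMulVec h)
    rw [if_neg hC, if_neg hnpd, zero_mul]

/-! ### The induction -/

/-- Two probability measures: integrating a function of the second coordinate against a product
with a probability first factor. [folklore] -/
theorem lintegral_prod_of_snd {α β : Type*} [MeasurableSpace α] [MeasurableSpace β]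
    (μ : Measure α) (ν : Measure β) [IsProbabilityMeasure μ] [SFinite ν] {G : β → ℝ≥0∞}
    (hG : Measurable G) : ∫⁻ z, G z.2 ∂(μ.prod ν) = ∫⁻ y, G y ∂ν := by
  rw [lintegral_prod (fun z : α × β => G z.2) (hG.comp measurable_snd).aemeasurable]
  simp only [lintegral_const, measure_univ, mul_one]

/-- **The law of the corner columns** (column induction): for `p + q ≤ m` there is `c > 0` with
`law(cornerCols) = c · det(1 - ∑ⱼ aⱼ aⱼ*)^{m-p-q} 𝟙_{>0} dA`. [folklore] -/
theorem map_cornerCols_eq_withDensity (hp : p ≤ m) :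
    ∀ q : ℕ, p + q ≤ m → ∃ c : ℝ, 0 < c ∧
      cornerLaw m hp q = volume.withDensity fun A => ENNReal.ofReal (c * cornerDensity (m - p - q) A) := by
  intro q
  induction q with
  | zero =>
    intro _
    exact ⟨1, one_pos, by simpa using cornerLaw_zero hp⟩
  | succ q ih =>
    intro hq
    obtain ⟨c, hc0, hIH⟩ := ih (by omega)
    obtain ⟨K, hK0, hK⟩ := map_normalizeMulVec_stdGaussian (p := p) (M := m - q) (by omega)
    refine ⟨c * K, mul_pos hc0 hK0, ?_⟩
    -- notation
    set γ : Measure (EuclideanSpace ℂ (Fin m)) := stdGaussian (EuclideanSpace ℂ (Fin m)) with hγ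
    have hexp : m - p - q = (m - p - (q + 1)) + 1 := by omega
    set ex : ℕ := m - p - (q + 1) with hex
    have hex' : m - q - p - 1 = ex := by omega
    rw [hexp] at hIH
    rw [hex'] at hK
    -- the split `Fin (q+1) → V ≃ V × (Fin q → V)` at the last index
    set eV := MeasurableEquiv.piFinSuccAbove (fun _ : Fin (q + 1) => EuclideanSpace ℂ (Fin m)) (Fin.last q)
      with heV
    have hmpV : MeasurePreserving eV (gaussianCols m (q + 1)) (γ.prod (gaussianCols m q)) :=
      measurePreserving_piFinSuccAbove (fun _ : Fin (q + 1) => stdGaussian (EuclideanSpace ℂ (Fin m)))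
        (Fin.last q)
    have heV_symm : ∀ x : EuclideanSpace ℂ (Fin m) × (Fin q → EuclideanSpace ℂ (Fin m)),
        eV.symm x = Fin.snoc x.2 x.1 := by
      intro x
      rw [heV, MeasurableEquiv.piFinSuccAbove_symm_apply, Fin.insertNthEquiv_last]
      rfl
    -- the split `Fin (q+1) → W ≃ W × (Fin q → W)` for the volume
    set eW := MeasurableEquiv.piFinSuccAbove (fun _ : Fin (q + 1) => EuclideanSpace ℂ (Fin p)) (Fin.last q)
      with heW
    have hmpW : MeasurePreserving eW volume ((volume : Measure (EuclideanSpace ℂ (Fin p))).prod volume) :=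
      volume_preserving_piFinSuccAbove (fun _ : Fin (q + 1) => EuclideanSpace ℂ (Fin p)) (Fin.last q)
    have heW_symm : ∀ x : EuclideanSpace ℂ (Fin p) × (Fin q → EuclideanSpace ℂ (Fin p)),
        eW.symm x = Fin.snoc x.2 x.1 := by
      intro x
      rw [heW, MeasurableEquiv.piFinSuccAbove_symm_apply, Fin.insertNthEquiv_last]
      rfl
    -- joint density on `W × (Fin q → W)`
    set D : EuclideanSpace ℂ (Fin p) × (Fin q → EuclideanSpace ℂ (Fin p)) → ℝ≥0∞ :=
      fun x => ENNReal.ofReal (c * K * cornerDensity ex (Fin.snoc x.2 x.1 : Fin (q + 1) → _)) with hD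
    have hDm : Measurable D := by
      refine ENNReal.measurable_ofReal.comp (measurable_const.mul ?_)
      have h1 : Measurable fun x : EuclideanSpace ℂ (Fin p) × (Fin q → EuclideanSpace ℂ (Fin p)) =>
          (Fin.snoc x.2 x.1 : Fin (q + 1) → EuclideanSpace ℂ (Fin p)) := by
        have : (fun x : EuclideanSpace ℂ (Fin p) × (Fin q → EuclideanSpace ℂ (Fin p)) =>
            (Fin.snoc x.2 x.1 : Fin (q + 1) → EuclideanSpace ℂ (Fin p))) = eW.symm := funext fun x =>
          (heW_symm x).symm
        rw [this]; exact eW.symm.measurable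
      exact (measurable_cornerDensity ex (q + 1)).comp h1
    have hDfac : ∀ (A' : Fin q → EuclideanSpace ℂ (Fin p)) (a : EuclideanSpace ℂ (Fin p)),
        D (a, A') = ENNReal.ofReal (c * cornerDensity (ex + 1) A') *
          ENNReal.ofReal (K * condDensity ex (gramCompl A') a) := by
      intro A' a
      rw [hD]
      dsimp only
      rw [← ENNReal.ofReal_mul (mul_nonneg hc0.le (cornerDensity_nonneg _ _))]
      congr 1
      rw [← cornerDensity_mul_condDensity]
      ring
    -- a.e. properties of the first `q` vectors
    have hpd : ∀ᵐ f' ∂(gaussianCols m q), (gramCompl (cornerCols hp f')).PosDef := by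
      rw [ae_iff]
      have hS := measurableSet_posDef_gramCompl (p := p) q
      have hset : {f' : Fin q → EuclideanSpace ℂ (Fin m) | ¬ (gramCompl (cornerCols hp f')).PosDef} =
          cornerCols hp ⁻¹' {A | (gramCompl A).PosDef}ᶜ := rfl
      rw [hset, ← Measure.map_apply (measurable_cornerCols hp q) hS.compl]
      change cornerLaw m hp q {A | (gramCompl A).PosDef}ᶜ = 0
      rw [hIH, withDensity_apply _ hS.compl]
      have hzero : ∀ A ∈ ({A : Fin q → EuclideanSpace ℂ (Fin p) | (gramCompl A).PosDef}ᶜ),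
          ENNReal.ofReal (c * cornerDensity (ex + 1) A) = 0 := by
        intro A hA
        have hA' : ¬ (gramCompl A).PosDef := hA
        rw [cornerDensity, if_neg hA', mul_zero, ENNReal.ofReal_zero]
      rw [setLIntegral_congr_fun hS.compl hzero, lintegral_zero]
    have hae := (ae_linearIndependent_gaussianCols (m := m) (q := q) (by omega)).and hpd
    -- the test-function side: `Ψ(A') = ∫ φ(A', a) K cond(C(A'), a) da`
    refine Measure.ext_of_lintegral _ fun φ hφ => ?_
    have hsnocW : ∀ A' : Fin q → EuclideanSpace ℂ (Fin p), Measurable fun a : EuclideanSpace ℂ (Fin p) =>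
        (Fin.snoc A' a : Fin (q + 1) → EuclideanSpace ℂ (Fin p)) := by
      intro A'
      have : (fun a : EuclideanSpace ℂ (Fin p) => (Fin.snoc A' a : Fin (q + 1) → EuclideanSpace ℂ (Fin p))) =
          eW.symm ∘ fun a => (a, A') := funext fun a => (heW_symm (a, A')).symm
      rw [this]
      exact eW.symm.measurable.comp (measurable_id.prodMk measurable_const)
    set Ψ : (Fin q → EuclideanSpace ℂ (Fin p)) → ℝ≥0∞ := fun A' =>
      ∫⁻ a, φ (Fin.snoc A' a : Fin (q + 1) → EuclideanSpace ℂ (Fin p)) *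
        ENNReal.ofReal (K * condDensity ex (gramCompl A') a) with hΨ
    have hΨm : Measurable Ψ := by
      have hG : Measurable fun x : (Fin q → EuclideanSpace ℂ (Fin p)) × EuclideanSpace ℂ (Fin p) =>
          φ (Fin.snoc x.1 x.2 : Fin (q + 1) → EuclideanSpace ℂ (Fin p)) *
            ENNReal.ofReal (K * condDensity ex (gramCompl x.1) x.2) := by
        refine Measurable.mul ?_ ?_
        · have : (fun x : (Fin q → EuclideanSpace ℂ (Fin p)) × EuclideanSpace ℂ (Fin p) =>
              (Fin.snoc x.1 x.2 : Fin (q + 1) → EuclideanSpace ℂ (Fin p))) = eW.symm ∘ Prod.swap :=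
            funext fun x => (heW_symm (x.2, x.1)).symm
          have h1 : Measurable fun x : (Fin q → EuclideanSpace ℂ (Fin p)) × EuclideanSpace ℂ (Fin p) =>
              (Fin.snoc x.1 x.2 : Fin (q + 1) → EuclideanSpace ℂ (Fin p)) := by
            rw [this]; exact eW.symm.measurable.comp measurable_swap
          exact hφ.comp h1
        · exact ENNReal.measurable_ofReal.comp (measurable_const.mul
            (measurable_condDensity_comp ex (continuous_gramCompl q)))
      exact hG.lintegral_prod_right'
    -- Step A: the inner integral for good `f'`
    have hinner : ∀ f' : Fin q → EuclideanSpace ℂ (Fin m),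
        LinearIndependent ℂ f' ∧ (gramCompl (cornerCols hp f')).PosDef →
        ∫⁻ g, φ (cornerCols hp (Fin.snoc f' g : Fin (q + 1) → EuclideanSpace ℂ (Fin m))) ∂γ =
          Ψ (cornerCols hp f') := by
      rintro f' ⟨hli, hposdef⟩
      obtain ⟨B, N, hNN, hcols⟩ := exists_cornerCols_snoc_eq hp (by omega) hli
      set A' := cornerCols hp f' with hA'
      have hCpd : (N * Nᴴ).PosDef := by rw [hNN]; exact hposdef
      simp_rw [hcols]
      have hS : Measurable fun g : EuclideanSpace ℂ (Fin m) => euclSplit (B.repr g) :=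
        (EuclideanSpace.sumEquivProd (𝕜 := ℂ) (ι := Fin q) (κ := Fin (m - q))).continuous.measurable.comp
          B.repr.continuous.measurable
      have hG : Measurable fun z : EuclideanSpace ℂ (Fin q) × EuclideanSpace ℂ (Fin (m - q)) =>
          φ (Fin.snoc A' (normalizeMulVec N z.2) : Fin (q + 1) → EuclideanSpace ℂ (Fin p)) :=
        hφ.comp ((hsnocW A').comp ((measurable_normalizeMulVec N).comp measurable_snd))
      calc ∫⁻ g, φ (Fin.snoc A' (normalizeMulVec N (euclSplit (B.repr g)).2) :
              Fin (q + 1) → EuclideanSpace ℂ (Fin p)) ∂γ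
          = ∫⁻ z, φ (Fin.snoc A' (normalizeMulVec N z.2) : Fin (q + 1) → EuclideanSpace ℂ (Fin p))
              ∂(γ.map fun g => euclSplit (B.repr g)) := (lintegral_map hG hS).symm
        _ = ∫⁻ z, φ (Fin.snoc A' (normalizeMulVec N z.2) : Fin (q + 1) → EuclideanSpace ℂ (Fin p))
              ∂((stdGaussian (EuclideanSpace ℂ (Fin q))).prod (stdGaussian (EuclideanSpace ℂ (Fin (m - q))))) := by
            rw [hγ, map_euclSplit_repr_stdGaussian B]
        _ = ∫⁻ cv, φ (Fin.snoc A' (normalizeMulVec N cv) : Fin (q + 1) → EuclideanSpace ℂ (Fin p))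
              ∂(stdGaussian (EuclideanSpace ℂ (Fin (m - q)))) :=
            lintegral_prod_of_snd _ _ (hφ.comp ((hsnocW A').comp (measurable_normalizeMulVec N)))
        _ = ∫⁻ a, φ (Fin.snoc A' a : Fin (q + 1) → EuclideanSpace ℂ (Fin p))
              ∂((stdGaussian (EuclideanSpace ℂ (Fin (m - q)))).map (normalizeMulVec N)) :=
            (lintegral_map (hφ.comp (hsnocW A')) (measurable_normalizeMulVec N)).symm
        _ = ∫⁻ a, φ (Fin.snoc A' a : Fin (q + 1) → EuclideanSpace ℂ (Fin p))
              ∂(volume.withDensity fun a => ENNReal.ofReal (K * condDensity ex (N * Nᴴ) a)) := by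
            rw [hK N hCpd]
        _ = Ψ A' := by
            have hφA : Measurable fun a : EuclideanSpace ℂ (Fin p) =>
                φ (Fin.snoc A' a : Fin (q + 1) → EuclideanSpace ℂ (Fin p)) := hφ.comp (hsnocW A')
            rw [lintegral_withDensity_eq_lintegral_mul _ (by fun_prop) hφA, hNN]
            refine lintegral_congr fun a => ?_
            rw [Pi.mul_apply, mul_comm]
    -- Step B: assemble
    have hmeasV : Measurable fun x : EuclideanSpace ℂ (Fin m) × (Fin q → EuclideanSpace ℂ (Fin m)) =>
        φ (cornerCols hp (Fin.snoc x.2 x.1 : Fin (q + 1) → EuclideanSpace ℂ (Fin m))) := by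
      have : (fun x : EuclideanSpace ℂ (Fin m) × (Fin q → EuclideanSpace ℂ (Fin m)) =>
          (Fin.snoc x.2 x.1 : Fin (q + 1) → EuclideanSpace ℂ (Fin m))) = eV.symm :=
        funext fun x => (heV_symm x).symm
      have h1 : Measurable fun x : EuclideanSpace ℂ (Fin m) × (Fin q → EuclideanSpace ℂ (Fin m)) =>
          (Fin.snoc x.2 x.1 : Fin (q + 1) → EuclideanSpace ℂ (Fin m)) := by
        rw [this]; exact eV.symm.measurable
      exact hφ.comp ((measurable_cornerCols hp (q + 1)).comp h1)
    have hsnocW' : Measurable fun x : EuclideanSpace ℂ (Fin p) × (Fin q → EuclideanSpace ℂ (Fin p)) =>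
        (Fin.snoc x.2 x.1 : Fin (q + 1) → EuclideanSpace ℂ (Fin p)) := by
      have : (fun x : EuclideanSpace ℂ (Fin p) × (Fin q → EuclideanSpace ℂ (Fin p)) =>
          (Fin.snoc x.2 x.1 : Fin (q + 1) → EuclideanSpace ℂ (Fin p))) = eW.symm :=
        funext fun x => (heW_symm x).symm
      rw [this]; exact eW.symm.measurable
    have hmeasD : Measurable fun x : EuclideanSpace ℂ (Fin p) × (Fin q → EuclideanSpace ℂ (Fin p)) =>
        φ (Fin.snoc x.2 x.1 : Fin (q + 1) → EuclideanSpace ℂ (Fin p)) * D x :=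
      (hφ.comp hsnocW').mul hDm
    calc ∫⁻ A, φ A ∂(cornerLaw m hp (q + 1))
        = ∫⁻ f, φ (cornerCols hp f) ∂(gaussianCols m (q + 1)) :=
          lintegral_map hφ (measurable_cornerCols hp (q + 1))
      _ = ∫⁻ x, φ (cornerCols hp (eV.symm x)) ∂(γ.prod (gaussianCols m q)) := by
          rw [← hmpV.symm.lintegral_comp_emb eV.symm.measurableEmbedding]
      _ = ∫⁻ x, φ (cornerCols hp (Fin.snoc x.2 x.1 : Fin (q + 1) → EuclideanSpace ℂ (Fin m)))
            ∂(γ.prod (gaussianCols m q)) := by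
          simp_rw [heV_symm]
      _ = ∫⁻ f', ∫⁻ g, φ (cornerCols hp (Fin.snoc f' g : Fin (q + 1) → EuclideanSpace ℂ (Fin m))) ∂γ
            ∂(gaussianCols m q) := lintegral_prod_symm _ hmeasV.aemeasurable
      _ = ∫⁻ f', Ψ (cornerCols hp f') ∂(gaussianCols m q) := by
          refine lintegral_congr_ae ?_
          filter_upwards [hae] with f' hf'
          exact hinner f' hf'
      _ = ∫⁻ A', Ψ A' ∂(cornerLaw m hp q) := (lintegral_map hΨm (measurable_cornerCols hp q)).symm
      _ = ∫⁻ A', ENNReal.ofReal (c * cornerDensity (ex + 1) A') * Ψ A' := by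
          rw [hIH, lintegral_withDensity_eq_lintegral_mul _ (by fun_prop) hΨm]
          rfl
      _ = ∫⁻ A', ∫⁻ a, φ (Fin.snoc A' a : Fin (q + 1) → EuclideanSpace ℂ (Fin p)) * D (a, A') := by
          refine lintegral_congr fun A' => ?_
          have hGa : Measurable fun a : EuclideanSpace ℂ (Fin p) =>
              φ (Fin.snoc A' a : Fin (q + 1) → EuclideanSpace ℂ (Fin p)) *
                ENNReal.ofReal (K * condDensity ex (gramCompl A') a) :=
            (hφ.comp (hsnocW A')).mul (ENNReal.measurable_ofReal.comp
              (measurable_const.mul (measurable_condDensity ex _)))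
          rw [hΨ]
          dsimp only
          rw [← lintegral_const_mul _ hGa]
          refine lintegral_congr fun a => ?_
          rw [hDfac A' a]
          ring
      _ = ∫⁻ x, φ (Fin.snoc x.2 x.1 : Fin (q + 1) → EuclideanSpace ℂ (Fin p)) * D x
            ∂((volume : Measure (EuclideanSpace ℂ (Fin p))).prod volume) :=
          (lintegral_prod_symm _ hmeasD.aemeasurable).symm
      _ = ∫⁻ x, (fun A : Fin (q + 1) → EuclideanSpace ℂ (Fin p) =>
            φ A * ENNReal.ofReal (c * K * cornerDensity ex A)) (eW.symm x)
            ∂((volume : Measure (EuclideanSpace ℂ (Fin p))).prod volume) := by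
          refine lintegral_congr fun x => ?_
          rw [heW_symm]
      _ = ∫⁻ A, φ A * ENNReal.ofReal (c * K * cornerDensity ex A) :=
          hmpW.symm.lintegral_comp_emb eW.symm.measurableEmbedding
            (fun A : Fin (q + 1) → EuclideanSpace ℂ (Fin p) => φ A * ENNReal.ofReal (c * K * cornerDensity ex A))
      _ = ∫⁻ A, φ A ∂(volume.withDensity fun A => ENNReal.ofReal (c * K * cornerDensity ex A)) := by
          rw [lintegral_withDensity_eq_lintegral_mul _ (by fun_prop) hφ]
          refine lintegral_congr fun A => ?_
          rw [Pi.mul_apply, mul_comm]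

/-! ### The corner of a Haar unitary -/

variable (m) in
/-- The **upper-left `p × q` corner** of a unitary `U ∈ U(m)`, as the `q`-tuple of its columns in
`ℂ^p`: `j ↦ (U i j)_{i < p}`. [folklore] -/
def haarCorner (hp : p ≤ m) {q : ℕ} (hq : q ≤ m) (U : unitaryGroup (Fin m) ℂ) :
    Fin q → EuclideanSpace ℂ (Fin p) :=
  fun j => topLin hp (firstCols m q hq U j)

/-- Entries of the corner. [folklore] -/
@[simp] theorem haarCorner_apply (hp : p ≤ m) {q : ℕ} (hq : q ≤ m) (U : unitaryGroup (Fin m) ℂ)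
    (j : Fin q) (i : Fin p) :
    haarCorner m hp hq U j i = (U : Matrix (Fin m) (Fin m) ℂ) (Fin.castLE hp i) (Fin.castLE hq j) := rfl

/-- The corner map is continuous. [folklore] -/
theorem continuous_haarCorner (hp : p ≤ m) {q : ℕ} (hq : q ≤ m) :
    Continuous (haarCorner m hp hq) :=
  continuous_pi fun j => (continuous_topLin hp).comp ((continuous_apply j).comp (continuous_firstCols q hq))

/-- The corner is `cornerCols` of the first columns. [folklore] -/
theorem haarCorner_eq_comp (hp : p ≤ m) {q : ℕ} (hq : q ≤ m) :
    haarCorner m hp hq = (fun w : Fin q → EuclideanSpace ℂ (Fin m) => fun j => topLin hp (w j)) ∘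
      firstCols m q hq := rfl

/-- **The law of a corner of a Haar unitary (Collins 2005, Thm. 5.1).** For `p + q ≤ m`, the
upper-left `p × q` corner `A = (aⱼ)_{j<q}` (columns `aⱼ ∈ ℂ^p`) of a Haar-distributed `U ∈ U(m)`
is absolutely continuous with respect to Lebesgue measure on `(ℂ^p)^q`, with density
`c · det (1 - ∑ⱼ aⱼ aⱼ*)^{m-p-q} 𝟙_{1 - ∑ⱼ aⱼ aⱼ* > 0} = c · det (1 - A A*)^{m-p-q} 𝟙_{‖A‖ < 1}`
for some constant `c > 0` (Collins states it for `m ≥ 2p ≥ 2q` with the indicator `‖A‖ ≤ 1`, equal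
a.e.; the normalising constant is not asserted). [cite: Collins2005, Thm. 5.1] -/
theorem map_haarCorner_eq_withDensity (hp : p ≤ m) {q : ℕ} (hq : q ≤ m) (hpq : p + q ≤ m) :
    ∃ c : ℝ, 0 < c ∧
      (haarProbability (unitaryGroup (Fin m) ℂ)).map (haarCorner m hp hq) =
        volume.withDensity fun A => ENNReal.ofReal (c * cornerDensity (m - p - q) A) := by
  obtain ⟨c, hc0, hc⟩ := map_cornerCols_eq_withDensity hp q hpq
  refine ⟨c, hc0, ?_⟩
  have htop : Measurable fun w : Fin q → EuclideanSpace ℂ (Fin m) => fun j => topLin hp (w j) :=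
    measurable_pi_lambda _ fun j => (continuous_topLin hp).measurable.comp (measurable_pi_apply j)
  rw [haarCorner_eq_comp, ← Measure.map_map htop (continuous_firstCols q hq).measurable,
    map_firstCols_haar_eq_map_gramSchmidtNormed hq, Measure.map_map htop (measurable_gramSchmidtNormed ℂ)]
  exact hc

end Literature.Probability.RandomMatrix
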